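import Literature.NumberTheory.LFunctions.Zhang2022.ObjectiveTwinDetTwoTerm

/-!
# Zhang (2022) design-space objective, twin part 18e: the EDGE witness for EVERY far-pair half-width `w` and EVERY `J`
# — `FormDet(shiftRecipe(1, J−w, J+w))(k₁ + (−1)^J k_J)` in closed form

Y. Zhang, *Discrete mean estimates and the Landau–Siegel zero*, arXiv:2211.02515v1 (2022)
[Zhang2022LandauSiegel] — an unrefereed manuscript under adjudication. **This file SEARCHES and TYPES; it
makes no claim about Landau–Siegel zeros, about Theorems 1–2 of the manuscript, or about a repaired (2.32),
until a kernel theorem says so.** LANDAU–SIEGEL programme, cell `landau-siegel`, §A Lean twin serving §D (edge ell).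

Parts 18c/18d typed the two tabulated edge families (`w = ½`, `w = ¼`). The pattern conjectured from them (cell
INBOX 2026-08-27T02:02:43Z) and confirmed numerically by two further engines at `w = 2/5` and other widths
(ls-Bmulti-num-1 g4 02:03:22Z, certified Arb balls; ls-ref-1 g2 02:07:54Z) is here a theorem for EVERY real
half-width `0 < w < 1` and every `J`: with `c = cos(πw)`, `s = sin(πw)`,

* `Det.formDet_edgeFamily_even` (`J` even, `J ≥ 2`, witness `k₁ + k_J`):
  `FormDet(shiftRecipe(1, J−w, J+w)) = −4(1 − c) − 2wπs·(1 + w²/(J(J−1−w)(J−1+w)))`;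
* `Det.formDet_edgeFamily_odd` (`J` odd, `J ≥ 3`, witness `k₁ − k_J`):
  `FormDet = −4(1 − c)·(1 + (2J−1)w²/(J²(J−1−w)(J−1+w))) − 2wπs·(1 + w²/(J(J−1−w)(J−1+w)))`;
hence the `J → ∞` edge value `−4(1 − cos πw) − 2πw·sin πw` (`w = ½`: `−(4+π)`; `w = ¼`: `−4 + 2√2 − √2π/4`).
Recipe data: `Det.shiftW_edgeFamily` (`W₀ = −i(−1)^J/((J−1−w)(J−1+w))`, `W₁ = ((J−w)/(2w(1+w−J)))·(−s + ic)`,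
`W₂ = ((J+w)/(2w(J−1+w)))·(s + ic)` — phases `e^{iπ(w+½)}`, `e^{iπ(½−w)}`). SCOPE: `b₀ = 1` is the INADMISSIBLE
edge (zero near-detuning); these are the exact shapes behind the numerics' «J-stable edge values», nothing about
admissible designs. Theorems only; no new definitions.
-/

noncomputable section

open Complex Real ComplexConjugate

namespace Literature.NumberTheory.LFunctions.Zhang2022

namespace Det

open Repair Objective

/-! ## Helpers -/

/-- `x / c_j = x·(1/(jπ))·i`. [folklore] -/
private theorem div_afeFreq₁₈e (x : ℂ) {j : ℕ} (hj : j ≠ 0) :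
    x / afeFreq j = x * (((1 / (j * π)) : ℝ) : ℂ) * Complex.I := by
  have hc := afeFreq_ne_zero hj
  rw [div_eq_iff hc]
  unfold afeFreq
  push_cast
  have hπ : (π : ℂ) ≠ 0 := Complex.ofReal_ne_zero.mpr Real.pi_ne_zero
  have hjc : (j : ℂ) ≠ 0 := Nat.cast_ne_zero.mpr hj
  field_simp
  ring_nf
  rw [Complex.I_sq]
  ring

/-- `1/c_j = (1/(jπ))·i`. [folklore] -/
private theorem afeFreq_inv₁₈e {j : ℕ} (hj : j ≠ 0) :
    (afeFreq j)⁻¹ = (((1 / (j * π)) : ℝ) : ℂ) * Complex.I := by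
  rw [inv_eq_one_div, div_afeFreq₁₈e 1 hj, one_mul]

/-- `c_j = −(jπ)·i`. [folklore] -/
private theorem afeFreq_eq₁₈e (j : ℕ) : afeFreq j = ((-(j * π) : ℝ) : ℂ) * Complex.I := by
  unfold afeFreq; push_cast; ring

/-- `e^{iπ(J − ½)} = −i·(−1)^J`. [folklore] -/
private theorem cexp_pi_mul_sub_half₁₈e (J : ℕ) :
    cexp (I * π * (((J : ℝ) - 1 / 2 : ℝ) : ℂ)) = -I * (-1) ^ J := by
  rw [show I * π * (((J : ℝ) - 1 / 2 : ℝ) : ℂ) = (J : ℂ) * (π * I) + (-(π / 2) : ℂ) * I by push_cast; ring,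
    Complex.exp_add, Complex.exp_nat_mul, Complex.exp_pi_mul_I, Complex.exp_mul_I, Complex.cos_neg, Complex.sin_neg,
    Complex.cos_pi_div_two, Complex.sin_pi_div_two]
  ring

/-- `e^{iπ(w + ½)} = −sin(πw) + i·cos(πw)`. [folklore] -/
private theorem cexp_pi_mul_add_half (w : ℝ) :
    cexp (I * π * ((w + 1 / 2 : ℝ) : ℂ)) =
      ((-(Real.sin (π * w)) : ℝ) : ℂ) + ((Real.cos (π * w) : ℝ) : ℂ) * I := by
  rw [show I * π * ((w + 1 / 2 : ℝ) : ℂ) = ((π * w : ℝ) : ℂ) * I + (π / 2 : ℂ) * I by push_cast; ring,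
    Complex.exp_add, Complex.exp_mul_I, Complex.exp_mul_I, Complex.cos_pi_div_two, Complex.sin_pi_div_two,
    ← Complex.ofReal_cos, ← Complex.ofReal_sin]
  push_cast
  ring_nf
  rw [Complex.I_sq]
  ring

/-- `e^{iπ(½ − w)} = sin(πw) + i·cos(πw)`. [folklore] -/
private theorem cexp_pi_mul_half_sub (w : ℝ) :
    cexp (I * π * ((1 / 2 - w : ℝ) : ℂ)) =
      ((Real.sin (π * w) : ℝ) : ℂ) + ((Real.cos (π * w) : ℝ) : ℂ) * I := by
  rw [show I * π * ((1 / 2 - w : ℝ) : ℂ) = ((-(π * w) : ℝ) : ℂ) * I + (π / 2 : ℂ) * I by push_cast; ring,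
    Complex.exp_add, Complex.exp_mul_I, Complex.exp_mul_I, Complex.cos_pi_div_two, Complex.sin_pi_div_two,
    ← Complex.ofReal_cos, ← Complex.ofReal_sin, Real.cos_neg, Real.sin_neg]
  push_cast
  ring_nf
  rw [Complex.I_sq]
  ring

/-! ## The recipe `shiftRecipe (1, J−w, J+w)` in closed form -/

/-- `s(1, J−w, J+w) = (2J, J+w+1, J−w+1)`. [cite: Zhang2022LandauSiegel, §8 (8.13)–(8.18)] -/
theorem shiftS_edgeFamily (J : ℕ) (w : ℝ) :
    shiftS ![1, (J : ℝ) - w, (J : ℝ) + w] = ![2 * (J : ℝ), (J : ℝ) + w + 1, (J : ℝ) - w + 1] := by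
  funext j; fin_cases j <;> (simp [shiftS]; try ring)

/-- `n(1, J−w, J+w) = (J² − w², J+w, J−w)`. [cite: Zhang2022LandauSiegel, §8 (8.13)–(8.18)] -/
theorem shiftN_edgeFamily (J : ℕ) (w : ℝ) :
    shiftN ![1, (J : ℝ) - w, (J : ℝ) + w] = ![(J : ℝ) ^ 2 - w ^ 2, (J : ℝ) + w, (J : ℝ) - w] := by
  funext j; fin_cases j <;> (simp [shiftN]; try ring)

/-- **`W(1, J−w, J+w)`** symbolic in `J` and `w`: `W₀ = (1/((J−1−w)(J−1+w)))·(−i(−1)^J)`,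
`W₁ = ((J−w)/(2w(1+w−J)))·(−sin πw + i cos πw)`, `W₂ = ((J+w)/(2w(J−1+w)))·(sin πw + i cos πw)`.
[cite: Zhang2022LandauSiegel, proof of Prop 7.1, (7.19)–(7.21)] -/
theorem shiftW_edgeFamily (J : ℕ) (w : ℝ) :
    shiftW ![1, (J : ℝ) - w, (J : ℝ) + w] =
      ![(((1 / (((J : ℝ) - 1 - w) * ((J : ℝ) - 1 + w))) : ℝ) : ℂ) * (-I * (-1) ^ J),
        ((((J : ℝ) - w) / (2 * w * (1 + w - (J : ℝ))) : ℝ) : ℂ) *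
          (((-(Real.sin (π * w)) : ℝ) : ℂ) + ((Real.cos (π * w) : ℝ) : ℂ) * I),
        ((((J : ℝ) + w) / (2 * w * ((J : ℝ) - 1 + w)) : ℝ) : ℂ) *
          (((Real.sin (π * w) : ℝ) : ℂ) + ((Real.cos (π * w) : ℝ) : ℂ) * I)] := by
  funext j
  fin_cases j
  · simp only [shiftW, shiftS, shiftVdm]
    simp only [Fin.zero_eta, Fin.isValue, Matrix.cons_val_zero, Matrix.cons_val_one, Matrix.head_cons,
      Matrix.cons_val_two, Matrix.tail_cons]
    rw [show (((J : ℝ) - w + ((J : ℝ) + w) - 1) / 2 : ℝ) = (J : ℝ) - 1 / 2 by ring, cexp_pi_mul_sub_half₁₈e]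
    push_cast
    rw [show ((J : ℂ) - w - 1) * ((J : ℂ) + w - 1) = ((J : ℂ) - 1 - w) * ((J : ℂ) - 1 + w) by ring]
    ring
  · simp only [shiftW, shiftS, shiftVdm]
    simp only [Fin.mk_one, Fin.isValue, Matrix.cons_val_zero, Matrix.cons_val_one, Matrix.head_cons,
      Matrix.cons_val_two, Matrix.tail_cons]
    rw [show ((((J : ℝ) + w + 1 - ((J : ℝ) - w)) / 2 : ℝ)) = (w + 1 / 2 : ℝ) by ring, cexp_pi_mul_add_half]
    push_cast
    rw [show ((J : ℂ) + w - ((J : ℂ) - w)) * (1 - ((J : ℂ) - w)) = 2 * (w : ℂ) * (1 + w - (J : ℂ)) by ring]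
    ring
  · simp only [shiftW, shiftS, shiftVdm]
    simp only [Fin.reduceFinMk, Fin.isValue, Matrix.cons_val_zero, Matrix.cons_val_one, Matrix.head_cons,
      Matrix.cons_val_two, Matrix.tail_cons]
    rw [show (((1 + ((J : ℝ) - w) - ((J : ℝ) + w)) / 2 : ℝ)) = (1 / 2 - w : ℝ) by ring, cexp_pi_mul_half_sub]
    push_cast
    rw [show (1 - ((J : ℂ) + w)) * ((J : ℂ) - w - ((J : ℂ) + w)) = 2 * (w : ℂ) * ((J : ℂ) - 1 + w) by ring]
    ring

/-! ## Even `J`: witness `k₁ + k_J` -/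

/-- **THE EDGE VALUE, EVEN `J ≥ 2`, ANY `0 < w < 1`**: `FormDet (shiftRecipe (1, J−w, J+w)) (k₁ + k_J) =
−4(1 − cos πw) − 2wπ·sin(πw)·(1 + w²/(J(J−1−w)(J−1+w)))`.
[cite: Zhang2022LandauSiegel, Prop 7.1 p.44 with (8.11)–(8.23); §2 (2.13)] -/
theorem formDet_edgeFamily_even {J : ℕ} (hJ : Even J) (hJge : 2 ≤ J) {w : ℝ} (hw0 : 0 < w) (hw1 : w < 1) :
    FormDet (shiftRecipe ![1, (J : ℝ) - w, (J : ℝ) + w]) (fun y => (1:ℂ) * afeDir 1 y + 1 * afeDir J y)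
        (fun y => (1:ℂ) * afeDir' 1 y + 1 * afeDir' J y) =
      -4 * (1 - Real.cos (π * w))
        - 2 * w * π * Real.sin (π * w) * (1 + w ^ 2 / ((J : ℝ) * ((J : ℝ) - 1 - w) * ((J : ℝ) - 1 + w))) := by
  have hJ1 : 1 < J := by omega
  have hJne : J ≠ 0 := by omega
  have hJm1 : J - 1 ≠ 0 := by omega
  have hpow : (-1 : ℂ) ^ J = 1 := hJ.neg_one_pow
  have hpow1 : (-1 : ℂ) ^ (J - 1) = -(1) := by
    have h := pow_succ (-1 : ℂ) (J - 1)
    rw [Nat.sub_add_cancel hJ1.le, hpow] at h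
    linear_combination h
  have h1 : (1:ℂ) * (-1) ^ 1 + 1 * (-1) ^ J = 0 := by rw [hpow]; norm_num
  rw [formDet_recipe_twoTerm _ one_ne_zero hJ1 1 1 h1]
  simp only [shiftRecipe, shiftW_edgeFamily, shiftS_edgeFamily, shiftN_edgeFamily, Fin.sum_univ_three]
  simp only [Fin.isValue, Matrix.cons_val_zero, Matrix.cons_val_one, Matrix.head_cons, Matrix.cons_val_two,
    Matrix.tail_cons]
  rw [hpow, hpow1]
  simp only [pow_one, div_eq_mul_inv, afeFreq_inv₁₈e one_ne_zero, afeFreq_inv₁₈e hJne, afeFreq_inv₁₈e hJm1]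
  simp only [afeFreq_eq₁₈e]
  have hcast : ((J - 1 : ℕ) : ℝ) = (J : ℝ) - 1 := by push_cast [Nat.cast_sub hJ1.le]; ring
  simp only [hcast]
  have hπ : π ≠ 0 := Real.pi_ne_zero
  have hJr : (J : ℝ) ≠ 0 := Nat.cast_ne_zero.mpr hJne
  have hJ2r : (2:ℝ) ≤ J := by exact_mod_cast (show 2 ≤ J by omega)
  have hJr1 : (J : ℝ) - 1 ≠ 0 := by linarith
  have hw : w ≠ 0 := hw0.ne'
  have hd1 : (J : ℝ) - 1 - w ≠ 0 := by linarith
  have hd1' : 1 + w - (J : ℝ) ≠ 0 := by linarith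
  have hd2 : (J : ℝ) - 1 + w ≠ 0 := by linarith
  have hP : ((J : ℝ) - 1 - w) * ((J : ℝ) - 1 + w) ≠ 0 := mul_ne_zero hd1 hd2
  have hP1 : 2 * w * (1 + w - (J : ℝ)) ≠ 0 := mul_ne_zero (mul_ne_zero two_ne_zero hw) hd1'
  have hP2 : 2 * w * ((J : ℝ) - 1 + w) ≠ 0 := mul_ne_zero (mul_ne_zero two_ne_zero hw) hd2
  simp only [map_add, map_mul, map_sub, map_neg, map_one, Complex.conj_ofReal, Complex.conj_I,
    Complex.add_re, Complex.add_im, Complex.sub_re, Complex.sub_im, Complex.mul_re, Complex.mul_im,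
    Complex.neg_re, Complex.neg_im, Complex.I_re, Complex.I_im, Complex.ofReal_re, Complex.ofReal_im,
    Complex.one_re, Complex.one_im]
  push_cast
  field_simp
  ring

/-! ## Odd `J`: witness `k₁ − k_J` -/

set_option maxHeartbeats 400000 in
/-- **THE EDGE VALUE, ODD `J ≥ 3`, ANY `0 < w < 1`**: `FormDet (shiftRecipe (1, J−w, J+w)) (k₁ − k_J) =
−4(1 − cos πw)(1 + (2J−1)w²/(J²(J−1−w)(J−1+w))) − 2wπ·sin(πw)·(1 + w²/(J(J−1−w)(J−1+w)))`.
[cite: Zhang2022LandauSiegel, Prop 7.1 p.44 with (8.11)–(8.23); §2 (2.13)] -/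
theorem formDet_edgeFamily_odd {J : ℕ} (hJ : Odd J) (hJge : 3 ≤ J) {w : ℝ} (hw0 : 0 < w) (hw1 : w < 1) :
    FormDet (shiftRecipe ![1, (J : ℝ) - w, (J : ℝ) + w]) (fun y => (1:ℂ) * afeDir 1 y + (-1) * afeDir J y)
        (fun y => (1:ℂ) * afeDir' 1 y + (-1) * afeDir' J y) =
      -4 * (1 - Real.cos (π * w)) * (1 + (2 * J - 1) * w ^ 2 / ((J : ℝ) ^ 2 * ((J : ℝ) - 1 - w) * ((J : ℝ) - 1 + w)))
        - 2 * w * π * Real.sin (π * w) * (1 + w ^ 2 / ((J : ℝ) * ((J : ℝ) - 1 - w) * ((J : ℝ) - 1 + w))) := by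
  have hJ1 : 1 < J := by omega
  have hJne : J ≠ 0 := by omega
  have hJm1 : J - 1 ≠ 0 := by omega
  have hpow : (-1 : ℂ) ^ J = -1 := hJ.neg_one_pow
  have hpow1 : (-1 : ℂ) ^ (J - 1) = -(-1) := by
    have h := pow_succ (-1 : ℂ) (J - 1)
    rw [Nat.sub_add_cancel hJ1.le, hpow] at h
    linear_combination h
  have h1 : (1:ℂ) * (-1) ^ 1 + (-1) * (-1) ^ J = 0 := by rw [hpow]; norm_num
  rw [formDet_recipe_twoTerm _ one_ne_zero hJ1 1 (-1) h1]
  simp only [shiftRecipe, shiftW_edgeFamily, shiftS_edgeFamily, shiftN_edgeFamily, Fin.sum_univ_three]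
  simp only [Fin.isValue, Matrix.cons_val_zero, Matrix.cons_val_one, Matrix.head_cons, Matrix.cons_val_two,
    Matrix.tail_cons]
  rw [hpow, hpow1]
  simp only [pow_one, div_eq_mul_inv, afeFreq_inv₁₈e one_ne_zero, afeFreq_inv₁₈e hJne, afeFreq_inv₁₈e hJm1]
  simp only [afeFreq_eq₁₈e]
  have hcast : ((J - 1 : ℕ) : ℝ) = (J : ℝ) - 1 := by push_cast [Nat.cast_sub hJ1.le]; ring
  simp only [hcast]
  have hπ : π ≠ 0 := Real.pi_ne_zero
  have hJr : (J : ℝ) ≠ 0 := Nat.cast_ne_zero.mpr hJne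
  have hJ2r : (2:ℝ) ≤ J := by exact_mod_cast (show 2 ≤ J by omega)
  have hJr1 : (J : ℝ) - 1 ≠ 0 := by linarith
  have hw : w ≠ 0 := hw0.ne'
  have hd1 : (J : ℝ) - 1 - w ≠ 0 := by linarith
  have hd1' : 1 + w - (J : ℝ) ≠ 0 := by linarith
  have hd2 : (J : ℝ) - 1 + w ≠ 0 := by linarith
  have hP : ((J : ℝ) - 1 - w) * ((J : ℝ) - 1 + w) ≠ 0 := mul_ne_zero hd1 hd2
  have hP1 : 2 * w * (1 + w - (J : ℝ)) ≠ 0 := mul_ne_zero (mul_ne_zero two_ne_zero hw) hd1'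
  have hP2 : 2 * w * ((J : ℝ) - 1 + w) ≠ 0 := mul_ne_zero (mul_ne_zero two_ne_zero hw) hd2
  simp only [map_add, map_mul, map_sub, map_neg, map_one, Complex.conj_ofReal, Complex.conj_I,
    Complex.add_re, Complex.add_im, Complex.sub_re, Complex.sub_im, Complex.mul_re, Complex.mul_im,
    Complex.neg_re, Complex.neg_im, Complex.I_re, Complex.I_im, Complex.ofReal_re, Complex.ofReal_im,
    Complex.one_re, Complex.one_im]
  push_cast
  field_simp
  ring

end Det

end Literature.NumberTheory.LFunctions.Zhang2022
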